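import Literature.Computability.Complexity.PromiseMA
import Literature.Computability.Complexity.AaronsonVanMelkebeek2011Proofs
import Literature.Computability.Complexity.ExpTimeMaps
import Literature.Computability.Complexity.UnaryBricks
import Literature.Computability.Complexity.BranchingFn
import Literature.Computability.Complexity.TM2Iterate
import HarnessLib

/-!
# Scaling `pr-MA ⊆ pr-NP` up: Merlin–Arthur protocols with `2^{n/d}`-bit messages have `NTIME(2ⁿ)` simulations

Literature / complexity toolkit, companion of `PromiseMA.lean` (the promise class `PromiseMA'`).
The step of Buhrman–Fortnow–Pavan's proof of their Lemma 3.7 ("… by [KS04] the Merlin–Arthur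
protocol running in time `2^{O(ε)n}` can be simulated in `NTIME(2^{O(ε)n})`"; also item 2–3 of
the proof sketch of Hirahara's Lemma 3.4, ECCC TR21-058, p. 20) that turns the POLYNOMIAL
statement `pr-MA ⊆ pr-NP` into a statement about exponential-time Arthurs needs the exponent of
the `NP` simulation to be UNIFORM in the protocol. The textbook device (Arora–Barak 2009, §2.6.2
"translation upward by padding", with the clocked universal machine of Thm. 1.9 / §1.4.1) is a
single COMPLETE promise problem: this file carries it out on the tree's machine model.

* `MAScale.univRef U a` — the universal referee: on `⟨⟨inst, y⟩, z⟩` with `inst = ⟨e, ⟨x, u⟩⟩` it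
  asks the clocked universal acceptance language `U` (`clockedUniversalAcceptance_holds`,
  `ClockedUniversalAcceptanceProofs.lean`) whether the machine coded by `e` accepts `⟨⟨x, y⟩, z⟩`
  within the budget `|inst|^a`; `MAScale.Kprob U a` — its canonical promise problem (message and
  coin length `|inst|`), a member of `PromiseMA'` (`Kprob_mem_PromiseMA'`);
* `MAScale.instF e j x = ⟨e, ⟨x, 1^{2^m} 0 1^m⟩⟩`, `m = ⌊|x| / 2^j⌋` — the padded instance, of
  length `instLen e j |x| ≥ 2^{⌊|x|/2^j⌋}`, computed together with a unary clock in time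
  `(j + 1) · P(2^m + |x|)` for a polynomial `P` not depending on `j` (`exists_clock_machine`: copy,
  iterated halving `halfFn^[j]`, the exponential pad `expPad 1` of `ExpPadding.lean` under
  `mapFstAux`, pair plumbing);
* `MAScale.preimage_mem_NTIME` — for `L' ∈ P`, a code `e` and a polynomial `p₀` there is a slope
  `j` for which the language `{x | ∃ u, |u| ≤ p₀(|inst x|) ∧ ⟨inst x, u⟩ ∈ L'}` is in `NTIME(2ⁿ)` (the
  verifier is the truncating wrapper `truncMapAux` of the clock followed by a decider of
  `LenLe p₀ ⊓ L'`, verbatim the construction of `NP_subset_NTIME_two_pow`; the arithmetic is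
  `(j + 1) · Q(2^{⌊n/2^j⌋} + n) ≤ b · 2ⁿ + b` for `j` past the degree of `Q`,
  `exists_halving_bound`);
* **`MAScale.exists_NTIME_of_referee`** — if `PromiseMA' ⊆ PromiseNP` then for every `f ∈ FP`
  (Arthur's predicate, read on `⟨⟨x, y⟩, z⟩`, accepting by the value `[true]`) there are `d ≥ 1`, a
  message length `ℓ(n) ≥ 2^{⌊n/d⌋}`, a threshold `n₀` and `B ∈ NTIME(2ⁿ)` such that for `|x| ≥ n₀`:
  if SOME `y ∈ {0,1}^{ℓ(n)}` makes `f` accept with probability `≥ 2/3` over `z ∈ {0,1}^{ℓ(n)}` then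
  `x ∈ B`, and if EVERY such `y` is accepted with probability `≤ 1/3` then `x ∉ B` — Arthur's
  running time is automatically polynomial in `ℓ(n)`, i.e. `2^{O(n/d)}`, and the budget exponent
  `a` absorbs the polynomial of `f` and the overhead of the universal machine.

Under Hirahara's hypothesis `coNP × {U, T} ⊆ Avg¹_{1-n^{-c}}P` (or `DistNP ⊆ AvgP`) the premise
`PromiseMA' ⊆ PromiseNP` is the Köbler–Schuler theorem of the tree
(`Hirahara2021_PromiseMA'_subset_PromiseNP_of_Avg1P`, `MetaComplexity/AvgCaseMADerandomization.lean`);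
the consumer is the Merlin–Arthur protocol for `E` from infinitely-often small circuits in the
proof of BFP's Lemma 3.7 (messages = circuits of size `2^{εn}`).

## References

* H. Buhrman, L. Fortnow, A. Pavan, *Some results on derandomization*, Theory Comput. Syst. 38
  (2005) 211–227, Lemma 3.7 and its proof (the `NTIME(2^{εn})` simulation of `2^{εn}`-time
  Merlin–Arthur protocols) [BuhrmanFortnowPavan2004].
* S. Hirahara, *Average-case hardness of NP from exponential worst-case hardness assumptions*,
  ECCC TR21-058 (2021), Lemma 3.4, proof sketch, items 2–3 [Hirahara2021].
* S. Arora, B. Barak, *Computational Complexity: A Modern Approach*, CUP 2009, Thm. 1.9 and §1.4.1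
  (clocked universal machine), §2.6.2 (padding), Def. 8.10 (`MA`) [AroraBarakCC2009].
* J. Köbler, R. Schuler, *Average-case intractability vs. worst-case intractability*, Inform. and
  Comput. 190 (2004) (`pr-MA = pr-NP` under average-case easiness) [KoblerSchuler2004].
-/

noncomputable section

namespace Literature.Computability.Complexity

open _root_.Computability Turing Polynomial Brick Plumb

namespace MAScale

/-! ### Arithmetic -/

/-- Every polynomial is eventually dominated by a power: `Q(ℓ) ≤ ℓ^a` for `ℓ ≥ ℓ₁`. [folklore] -/
theorem exists_pow_ge_eval (Q : Polynomial ℕ) : ∃ a ℓ₁ : ℕ, ∀ ℓ : ℕ, ℓ₁ ≤ ℓ → Q.eval ℓ ≤ ℓ ^ a := by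
  obtain ⟨c, k, hck⟩ := exists_eval_le_mul_pow_add Q
  refine ⟨k + 1, 2 * c + 1, fun ℓ hℓ => ?_⟩
  have h1 : 1 ≤ ℓ ^ k := Nat.one_le_pow _ _ (by omega)
  calc Q.eval ℓ ≤ c * ℓ ^ k + c := hck ℓ
    _ ≤ c * ℓ ^ k + c * ℓ ^ k := Nat.add_le_add_left (by nlinarith) _
    _ = (2 * c) * ℓ ^ k := by ring
    _ ≤ ℓ * ℓ ^ k := Nat.mul_le_mul_right _ (by omega)
    _ = ℓ ^ (k + 1) := by ring

/-- **The halving exponent.** For every polynomial `Q` there are `j` and `b` with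
`(j + 1) · Q(2^{⌊n/2^j⌋} + n) ≤ b · 2ⁿ + b` for all `n` (take `j = k + 1` for `Q(N) ≤ c N^k + c`:
then `⌊n/2^j⌋ · k ≤ n/2` and `(n+1)^k = O(2^{n/2})`). [folklore] -/
theorem exists_halving_bound (Q : Polynomial ℕ) :
    ∃ j b : ℕ, ∀ n : ℕ, (j + 1) * Q.eval (2 ^ (n / 2 ^ j) + n) ≤ b * 2 ^ n + b := by
  obtain ⟨c, k, hck⟩ := exists_eval_le_mul_pow_add Q
  obtain ⟨C, hC⟩ := TimeConstructible.exists_pow_le_mul_two_pow k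
  refine ⟨k + 1, (k + 2) * (c * (2 ^ k * C * 2) + c), fun n => ?_⟩
  set m := n / 2 ^ (k + 1) with hm
  set N := 2 ^ m + n with hN
  have h2m : 1 ≤ 2 ^ m := Nat.one_le_two_pow
  have hNle : N ≤ 2 ^ m * (n + 1) := by rw [hN]; nlinarith
  have hmk : m * k ≤ n / 2 := by
    have hk : k ≤ 2 ^ k := Nat.lt_two_pow_self.le
    have hm' : m = n / 2 / 2 ^ k := by
      rw [hm, Nat.div_div_eq_div_mul, pow_succ, mul_comm]
    calc m * k ≤ m * 2 ^ k := Nat.mul_le_mul_left m hk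
      _ = n / 2 / 2 ^ k * 2 ^ k := by rw [hm']
      _ ≤ n / 2 := Nat.div_mul_le_self _ _
  have hn1 : (n + 1) ^ k ≤ 2 ^ k * C * 2 ^ (n / 2 + 1) := by
    have h1 : n + 1 ≤ 2 * (n / 2 + 1) := by omega
    calc (n + 1) ^ k ≤ (2 * (n / 2 + 1)) ^ k := Nat.pow_le_pow_left h1 k
      _ = 2 ^ k * (n / 2 + 1) ^ k := mul_pow _ _ _
      _ ≤ 2 ^ k * (C * 2 ^ (n / 2 + 1)) := Nat.mul_le_mul_left _ (hC _)
      _ = 2 ^ k * C * 2 ^ (n / 2 + 1) := by ring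
  have hpowN : N ^ k ≤ 2 ^ (n / 2) * (2 ^ k * C * 2 ^ (n / 2 + 1)) := by
    calc N ^ k ≤ (2 ^ m * (n + 1)) ^ k := Nat.pow_le_pow_left hNle k
      _ = 2 ^ (m * k) * (n + 1) ^ k := by rw [mul_pow, ← pow_mul]
      _ ≤ 2 ^ (n / 2) * (n + 1) ^ k :=
          Nat.mul_le_mul_right _ (Nat.pow_le_pow_right two_pos hmk)
      _ ≤ 2 ^ (n / 2) * (2 ^ k * C * 2 ^ (n / 2 + 1)) := Nat.mul_le_mul_left _ hn1
  have hexp : 2 ^ (n / 2) * 2 ^ (n / 2 + 1) ≤ 2 * 2 ^ n := by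
    rw [← pow_add, show n / 2 + (n / 2 + 1) = 2 * (n / 2) + 1 by ring, pow_succ]
    have : 2 ^ (2 * (n / 2)) ≤ 2 ^ n := Nat.pow_le_pow_right two_pos (Nat.mul_div_le n 2)
    omega
  have hQ : Q.eval N ≤ c * (2 ^ k * C * 2) * 2 ^ n + c := by
    calc Q.eval N ≤ c * N ^ k + c := hck N
      _ ≤ c * (2 ^ (n / 2) * (2 ^ k * C * 2 ^ (n / 2 + 1))) + c :=
          Nat.add_le_add_right (Nat.mul_le_mul_left c hpowN) c
      _ = c * (2 ^ k * C) * (2 ^ (n / 2) * 2 ^ (n / 2 + 1)) + c := by ring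
      _ ≤ c * (2 ^ k * C) * (2 * 2 ^ n) + c :=
          Nat.add_le_add_right (Nat.mul_le_mul_left _ hexp) c
      _ = c * (2 ^ k * C * 2) * 2 ^ n + c := by ring
  calc (k + 1 + 1) * Q.eval N ≤ (k + 2) * (c * (2 ^ k * C * 2) * 2 ^ n + c) := by
        rw [show k + 1 + 1 = k + 2 by ring]
        exact Nat.mul_le_mul_left _ hQ
    _ ≤ (k + 2) * (c * (2 ^ k * C * 2) + c) * 2 ^ n + (k + 2) * (c * (2 ^ k * C * 2) + c) := by
        have e : (k + 2) * (c * (2 ^ k * C * 2) + c) * 2 ^ n + (k + 2) * (c * (2 ^ k * C * 2) + c) =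
            (k + 2) * (c * (2 ^ k * C * 2) * 2 ^ n + c) +
              ((k + 2) * c * 2 ^ n + (k + 2) * (c * (2 ^ k * C * 2))) := by ring
        rw [e]
        exact Nat.le_add_right _ _

/-- Monotonicity of `uniformProb` under an implication restricted to strings of the sampled
length. [folklore] -/
private theorem uniformProb_mono_of_imp {m : ℕ} {E F : Set (List Bool)}
    (h : ∀ z : List Bool, z.length = m → z ∈ E → z ∈ F) : uniformProb m E ≤ uniformProb m F := by
  classical
  unfold uniformProb
  have hc : (Finset.univ.filter fun r : List.Vector Bool m => r.toList ∈ E).card ≤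
      (Finset.univ.filter fun r : List.Vector Bool m => r.toList ∈ F).card :=
    Finset.card_le_card fun r hr => by
      simp only [Finset.mem_filter, Finset.mem_univ, true_and] at hr ⊢
      exact h _ r.toList_length hr
  gcongr

/-- Membership in a set-builder language (local `Iff.rfl` helper). [folklore] -/
private theorem memL_setOf' {q : List Bool → Prop} {w : List Bool} :
    @Membership.mem (List Bool) (Language Bool) _ {z | q z} w ↔ q w := Iff.rfl

/-- Pointwise pairing of two `FP` functions is in `FP` (local helper). [folklore] -/
private theorem pairF_mem_FP {f g : List Bool → List Bool} (hf : f ∈ FP) (hg : g ∈ FP) :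
    (fun z => boolPair (f z) (g z)) ∈ FP := by
  have h : (fun z => boolPair (f z) (g z)) = fanoutFn f g := funext fun z => (fanoutFn_apply f g z).symm
  rw [h]
  exact fanoutFn_mem_FP hf hg

/-! ### Iterated halving -/

/-- `|halfFn^[j] w| = ⌊|w| / 2^j⌋`. [folklore] -/
theorem length_iterate_halfFn : ∀ (j : ℕ) (w : List Bool), (halfFn^[j] w).length = w.length / 2 ^ j
  | 0, w => by simp
  | j + 1, w => by
    rw [Function.iterate_succ_apply', length_halfFn, length_iterate_halfFn j w, pow_succ,
      Nat.div_div_eq_div_mul]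

/-- **A machine for `halfFn^[j]`** with running time `(j + 1) · q(n)` for a polynomial `q` not
depending on `j` (the identity machine followed by `j` runs of the halving brick, whose inputs only
shrink). [Arora–Barak 2009, §1.3] [cite: AroraBarakCC2009, §1.3] -/
theorem exists_iterate_halfFn_machine :
    ∃ q : Polynomial ℕ, ∀ j : ℕ, ∃ M : TM2ComputableAux Bool Bool, ∀ x : List Bool,
      M.OutputsWithin x (halfFn^[j] x) ((j + 1) * q.eval x.length) := by
  obtain ⟨q₀, M₀, hM₀⟩ := (ClockedUA.id_mem_FP : (fun w : List Bool => w) ∈ FP)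
  obtain ⟨q₁, M₁, hM₁⟩ := halfFn_mem_FP
  refine ⟨q₀ + q₁, fun j => ?_⟩
  induction j with
  | zero =>
    refine ⟨M₀, fun x => ?_⟩
    have h := hM₀ x
    simp only [id] at h
    refine h.mono ?_
    simp only [zero_add, one_mul, eval_add]
    omega
  | succ j ih =>
    obtain ⟨M, hM⟩ := ih
    refine ⟨M.comp M₁, fun x => ?_⟩
    have h₁ := hM x
    have h₂ := hM₁ (halfFn^[j] x)
    simp only [id] at h₂
    have h := TM2ComputableAux.comp_outputsWithin M M₁ h₁ h₂
    rw [← Function.iterate_succ_apply' halfFn j x] at h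
    refine h.mono ?_
    have hlen : (halfFn^[j] x).length ≤ x.length := by
      rw [length_iterate_halfFn]
      exact Nat.div_le_self _ _
    have hq : q₁.eval (halfFn^[j] x).length ≤ (q₀ + q₁).eval x.length := by
      rw [eval_add]
      exact (TM2Iter.eval_mono q₁ hlen).trans (Nat.le_add_left _ _)
    calc q₁.eval (halfFn^[j] x).length + (j + 1) * (q₀ + q₁).eval x.length
        ≤ (q₀ + q₁).eval x.length + (j + 1) * (q₀ + q₁).eval x.length := Nat.add_le_add_right hq _
      _ = (j + 1 + 1) * (q₀ + q₁).eval x.length := by ring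

/-! ### The padded instance and the clock -/

/-- The exponential pad at slope `2^{-j}`: `padJ j x = 1^{2^m} 0 (halfFn^[j] x)`, `m = ⌊|x|/2^j⌋`
(`expPad 1` of `ExpPadding.lean` after `j` halvings). [cite: AroraBarakCC2009, §2.6.2] -/
def padJ (j : ℕ) (x : List Bool) : List Bool := expPad 1 (halfFn^[j] x)

/-- Length of the pad: `2^m + m + 1`, `m = ⌊|x|/2^j⌋`. [folklore] -/
@[simp] theorem length_padJ (j : ℕ) (x : List Bool) :
    (padJ j x).length = 2 ^ (x.length / 2 ^ j) + x.length / 2 ^ j + 1 := by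
  simp [padJ, length_iterate_halfFn]

/-- **The padded instance** `instF e j x = ⟨e, ⟨x, padJ j x⟩⟩` (machine code, payload, pad — the
layout `⟨e, ⟨w, u⟩⟩` of the clocked universal acceptance language). [cite: AroraBarakCC2009, Thm. 1.9 and §2.6.2] -/
def instF (e : List Bool) (j : ℕ) (x : List Bool) : List Bool := boolPair e (boolPair x (padJ j x))

/-- The length of `instF e j x` as a function of `n = |x|`. [folklore] -/
def instLen (e : List Bool) (j n : ℕ) : ℕ :=
  2 * e.length + 2 + (2 * n + 2 + (2 ^ (n / 2 ^ j) + n / 2 ^ j + 1))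

/-- `|instF e j x| = instLen e j |x|`. [folklore] -/
@[simp] theorem length_instF (e : List Bool) (j : ℕ) (x : List Bool) :
    (instF e j x).length = instLen e j x.length := by
  simp [instF, instLen]

/-- The message length is at least `2^{⌊n/2^j⌋}`. [folklore] -/
theorem two_pow_le_instLen (e : List Bool) (j n : ℕ) : 2 ^ (n / 2 ^ j) ≤ instLen e j n := by
  unfold instLen
  exact le_add_left (le_add_left (le_add_right (Nat.le_add_right _ _)))

/-- The message length is at least `2n + 5`. [folklore] -/
theorem le_instLen (e : List Bool) (j n : ℕ) : 2 * n + 5 ≤ instLen e j n := by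
  unfold instLen
  generalize n / 2 ^ j = m
  have := Nat.one_le_two_pow (n := m)
  omega

/-- The message length is at most `3 · (2^m + n) + (2|e| + 5)`, `m = ⌊n/2^j⌋`. [folklore] -/
theorem instLen_le (e : List Bool) (j n : ℕ) :
    instLen e j n ≤ 3 * (2 ^ (n / 2 ^ j) + n) + (2 * e.length + 5) := by
  unfold instLen
  have hmn : n / 2 ^ j ≤ n := Nat.div_le_self _ _
  generalize n / 2 ^ j = m at hmn ⊢
  have := Nat.one_le_two_pow (n := m)
  omega

/-- **The clock word** `clockF e j p₀ x = ⟨instF e j x, 1^{p₀(|instF e j x|) + 1}⟩` (the padded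
instance with the exact admissible witness length of the simulation). [cite: AroraBarakCC2009, §2.6.2] -/
def clockF (e : List Bool) (j : ℕ) (p₀ : Polynomial ℕ) (x : List Bool) : List Bool :=
  boolPair (instF e j x) (ones (p₀.eval (instLen e j x.length) + 1))

/-- The polynomial-time last stage of the clock: `⟨u, x⟩ ↦ ⟨⟨e, ⟨x, u⟩⟩, 1^{p₀(|⟨e, ⟨x, u⟩⟩|) + 1}⟩`. [folklore] -/
def postF (e : List Bool) (p₀ : Polynomial ℕ) : List Bool → List Bool :=
  fun w => boolPair (boolPair e (boolPair (sndF w) (fstF w)))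
    (ones (p₀.eval (boolPair e (boolPair (sndF w) (fstF w))).length + 1))

/-- `postF e p₀ ∈ FP`. [cite: AroraBarakCC2009, §1.3] -/
theorem postF_mem_FP (e : List Bool) (p₀ : Polynomial ℕ) : postF e p₀ ∈ FP := by
  have hI : (fun w : List Bool => boolPair e (boolPair (sndF w) (fstF w))) ∈ FP :=
    pairF_mem_FP (const_mem_FP e) (pairF_mem_FP sndF_mem_FP fstF_mem_FP)
  have hO : (fun w : List Bool => ones (p₀.eval (boolPair e (boolPair (sndF w) (fstF w))).length + 1)) ∈ FP := by
    have heq : (fun w : List Bool => ones (p₀.eval (boolPair e (boolPair (sndF w) (fstF w))).length + 1)) =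
        polyFn (p₀ + 1) ∘ fun w : List Bool => boolPair e (boolPair (sndF w) (fstF w)) := by
      funext w
      simp only [Function.comp_apply, polyFn_apply, eval_add, eval_one]
    rw [heq]
    exact comp_mem_FP (polyFn_mem_FP _) hI
  exact pairF_mem_FP hI hO

/-- Value of `postF` on the pair `⟨padJ j x, x⟩`: the clock word. [folklore] -/
theorem postF_pad (e : List Bool) (j : ℕ) (p₀ : Polynomial ℕ) (x : List Bool) :
    postF e p₀ (boolPair (padJ j x) x) = clockF e j p₀ x := by
  unfold postF clockF
  rw [sndF_boolPair, fstF_boolPair, ← instF, length_instF]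

/-- **The clock machine.** There is a polynomial `P` such that for every `j` some machine computes
`clockF e j p₀` within `(j + 1) · P(2^{⌊n/2^j⌋} + n)` steps: copy the input (`copyFn`), run
`halfFn^[j]` and the exponential pad `expPad 1` on the first copy under `mapFstAux`
(`MapFstMachine.lean`; time `C · 2^m + C` for the pad, `exists_timeComputable_expPad`), then the
polynomial-time stage `postF` on a word of length `O(2^m + n)`.
[cite: AroraBarakCC2009, §1.3 and §2.6.2] -/
theorem exists_clock_machine (e : List Bool) (p₀ : Polynomial ℕ) :
    ∃ P : Polynomial ℕ, ∀ j : ℕ, ∃ N : TM2ComputableAux Bool Bool, ∀ x : List Bool,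
      N.OutputsWithin x (clockF e j p₀ x) ((j + 1) * P.eval (2 ^ (x.length / 2 ^ j) + x.length)) := by
  obtain ⟨qc, Mc, hMc⟩ := copyFn_mem_FP
  obtain ⟨q, hq⟩ := exists_iterate_halfFn_machine
  obtain ⟨C, Mp, hMp⟩ := exists_timeComputable_expPad (k := 1) le_rfl
  obtain ⟨qp, Mpost, hMpost⟩ := postF_mem_FP e p₀
  refine ⟨qc + q + (Polynomial.C C * X + Polynomial.C C) + (11 * X + 13) + qp.comp (3 * X + 4),
    fun j => ?_⟩
  obtain ⟨Mh, hMh⟩ := hq j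
  refine ⟨(Mc.comp (mapFstAux (Mh.comp Mp))).comp Mpost, fun x => ?_⟩
  set n := x.length with hn
  set m := n / 2 ^ j with hm
  -- stage 1: copy
  have h₁ : Mc.OutputsWithin x (boolPair x x) (qc.eval n) := by
    have h := hMc x
    simp only [id, copyFn_apply] at h
    exact h
  -- stage 2: halve `j` times and pad, on the first copy
  have hg : (Mh.comp Mp).OutputsWithin x (padJ j x) (C * 2 ^ m + C + (j + 1) * q.eval n) := by
    have ha := hMh x
    have hb := hMp (halfFn^[j] x)
    simp only [id, pow_one, length_iterate_halfFn] at hb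
    exact TM2ComputableAux.comp_outputsWithin Mh Mp ha hb
  have h₂ : (mapFstAux (Mh.comp Mp)).OutputsWithin (boolPair x x) (boolPair (padJ j x) x)
      (C * 2 ^ m + C + (j + 1) * q.eval n + 3 * (padJ j x).length + 2 * (boolPair x x).length + 6) := by
    have hg' : (Mh.comp Mp).OutputsWithin (boolUnpair (boolPair x x)).1 (padJ j x)
        (C * 2 ^ m + C + (j + 1) * q.eval n) := by
      simpa only [boolUnpair_boolPair] using hg
    have h := outputsWithin_mapFstAux (Mh.comp Mp) hg'
    rw [readRest_boolPair] at h
    exact h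
  -- stage 3: the polynomial-time layout
  have h₃ : Mpost.OutputsWithin (boolPair (padJ j x) x) (clockF e j p₀ x)
      (qp.eval (boolPair (padJ j x) x).length) := by
    have h := hMpost (boolPair (padJ j x) x)
    simp only [id, postF_pad] at h
    exact h
  have h12 := TM2ComputableAux.comp_outputsWithin Mc (mapFstAux (Mh.comp Mp)) h₁ h₂
  have h := TM2ComputableAux.comp_outputsWithin _ Mpost h12 h₃
  refine h.mono ?_
  -- the estimates, in `N = 2^m + n`
  have hmn : m ≤ n := by rw [hm]; exact Nat.div_le_self _ _
  have hpadlen : (padJ j x).length = 2 ^ m + m + 1 := by rw [length_padJ, ← hn, ← hm]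
  have hxx : (boolPair x x).length = 3 * n + 2 := by rw [length_boolPair, ← hn]; ring
  have hpx' : (boolPair (padJ j x) x).length = 2 * (2 ^ m + m + 1) + 2 + n := by
    rw [length_boolPair, hpadlen, ← hn]
  clear_value m n
  clear hm
  set N := 2 ^ m + n with hN
  have h2m : 1 ≤ 2 ^ m := Nat.one_le_two_pow
  have hpad : (padJ j x).length ≤ N + 1 := by rw [hpadlen]; omega
  have hpx : (boolPair (padJ j x) x).length ≤ 3 * N + 4 := by rw [hpx']; omega
  have e1 : qp.eval (boolPair (padJ j x) x).length ≤ (qp.comp (3 * X + 4)).eval N := by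
    rw [eval_comp]
    refine TM2Iter.eval_mono qp (hpx.trans (le_of_eq ?_))
    simp [eval_add, eval_mul, eval_X]
  have e2 : qc.eval n ≤ qc.eval N := TM2Iter.eval_mono qc (by omega)
  have e3 : q.eval n ≤ q.eval N := TM2Iter.eval_mono q (by omega)
  have e4 : C * 2 ^ m + C ≤ (Polynomial.C C * X + Polynomial.C C).eval N := by
    simp only [eval_add, eval_mul, eval_C, eval_X]
    exact Nat.add_le_add_right (Nat.mul_le_mul_left C (by omega)) C
  have e5 : 3 * (padJ j x).length + 2 * (boolPair x x).length + 6 ≤ (11 * X + 13 : Polynomial ℕ).eval N := by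
    simp only [eval_add, eval_mul, eval_ofNat, eval_X]; omega
  set P := qc + q + (Polynomial.C C * X + Polynomial.C C) + (11 * X + 13) + qp.comp (3 * X + 4) with hP
  have hPN : P.eval N = qc.eval N + q.eval N + (Polynomial.C C * X + Polynomial.C C).eval N +
      (11 * X + 13 : Polynomial ℕ).eval N + (qp.comp (3 * X + 4)).eval N := by
    simp only [hP, eval_add]
  have hj : q.eval N + (qc.eval N + (Polynomial.C C * X + Polynomial.C C).eval N +
      (11 * X + 13 : Polynomial ℕ).eval N + (qp.comp (3 * X + 4)).eval N) ≤ P.eval N := by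
    rw [hPN]; omega
  calc qp.eval (boolPair (padJ j x) x).length +
        (C * 2 ^ m + C + (j + 1) * q.eval n + 3 * (padJ j x).length + 2 * (boolPair x x).length + 6 +
          qc.eval n)
      ≤ (qp.comp (3 * X + 4)).eval N + ((Polynomial.C C * X + Polynomial.C C).eval N +
          (j + 1) * q.eval N + (11 * X + 13 : Polynomial ℕ).eval N + qc.eval N) := by
        have := Nat.mul_le_mul_left (j + 1) e3
        linarith
    _ = (j + 1) * q.eval N + (qc.eval N + (Polynomial.C C * X + Polynomial.C C).eval N +
          (11 * X + 13 : Polynomial ℕ).eval N + (qp.comp (3 * X + 4)).eval N) := by ring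
    _ ≤ (j + 1) * q.eval N + (j + 1) * (qc.eval N + (Polynomial.C C * X + Polynomial.C C).eval N +
          (11 * X + 13 : Polynomial ℕ).eval N + (qp.comp (3 * X + 4)).eval N) :=
        Nat.add_le_add_left (Nat.le_mul_of_pos_left _ (by omega)) _
    _ = (j + 1) * (q.eval N + (qc.eval N + (Polynomial.C C * X + Polynomial.C C).eval N +
          (11 * X + 13 : Polynomial ℕ).eval N + (qp.comp (3 * X + 4)).eval N)) := by ring
    _ ≤ (j + 1) * P.eval N := Nat.mul_le_mul_left _ hj

/-! ### The preimage of an `NP`-type language under the padded instance map is in `NTIME(2ⁿ)` -/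

/-- **The simulation language** `{x | ∃ u, |u| ≤ p₀(|instF e j x|) ∧ ⟨instF e j x, u⟩ ∈ L'}` — the
preimage under the padded instance map of the `NP` language presented by `(L', p₀)`. [folklore] -/
def simLang (e : List Bool) (j : ℕ) (L' : Language Bool) (p₀ : Polynomial ℕ) : Language Bool :=
  {x | ∃ u : List Bool, u.length ≤ p₀.eval (instLen e j x.length) ∧ boolPair (instF e j x) u ∈ L'}

/-- Membership in the simulation language (definitional). [folklore] -/
theorem mem_simLang_iff (e : List Bool) (j : ℕ) (L' : Language Bool) (p₀ : Polynomial ℕ) (x : List Bool) :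
    x ∈ simLang e j L' p₀ ↔
      ∃ u : List Bool, u.length ≤ p₀.eval (instLen e j x.length) ∧ boolPair (instF e j x) u ∈ L' :=
  Iff.rfl

/-- **The simulation language is in `NTIME(2ⁿ)` for a suitable slope.** For `L' ∈ P`, a machine
code `e` and a polynomial `p₀` there is `j` such that
`{x | ∃ u, |u| ≤ p₀(|instF e j x|) ∧ ⟨instF e j x, u⟩ ∈ L'} ∈ NTIME(2ⁿ)`: the verifier on `⟨x, y⟩`
is the truncating wrapper `truncMapAux` (`TruncMapMachine.lean`) of the clock machine — output
`⟨instF e j x, y ↾ (p₀(ℓ) + 1)⟩` within `(j+1) P(2^m + n) + O(ℓ + p₀ ℓ) + |y| / 2` steps — followed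
by a polynomial-time decider of `LenLe p₀ ⊓ L'` (as in `NP_subset_NTIME_two_pow`); all of it is
`(j + 1) · Q(2^{⌊n/2^j⌋} + n) + |y| / 2 ≤ b · 2ⁿ + b + |y| / 2` once `j` exceeds the degree of `Q`
(`exists_halving_bound`). [cite: AroraBarakCC2009, §2.6.2 and Thm. 2.6] -/
theorem preimage_mem_NTIME (e : List Bool) {L' : Language Bool} (hL' : L' ∈ Classes.P)
    (p₀ : Polynomial ℕ) : ∃ j : ℕ, simLang e j L' p₀ ∈ NTIME (fun n => 2 ^ n) := by
  -- a decider of `LenLe p₀ ⊓ L'`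
  have hL'' : LenLe p₀ ⊓ L' ∈ Classes.P := inter_mem_P (LenLe_mem_P p₀) hL'
  simp only [Classes.P, Set.mem_iUnion] at hL''
  obtain ⟨k, a, hdec⟩ := hL''
  obtain ⟨M, hM⟩ := (hdec : TimeDecidable id (LenLe p₀ ⊓ L') fun n => a * n ^ k + a)
  -- the clock and the slope
  obtain ⟨P, hP⟩ := exists_clock_machine e p₀
  set E₀ : ℕ := 2 * e.length + 5 with hE₀
  set L : Polynomial ℕ := 3 * X + Polynomial.C E₀ with hL
  set Q : Polynomial ℕ := P + (3 * L + 2 * (p₀.comp L + 1) + 2 * X + 11) +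
    (Polynomial.C a * (2 * L + 3 + p₀.comp L) ^ k + Polynomial.C a) + p₀.comp L with hQ
  obtain ⟨j, b, hb⟩ := exists_halving_bound Q
  obtain ⟨N, hN⟩ := hP j
  refine ⟨j, ?_⟩
  let V : TM2ComputableAux Bool Bool := (truncMapAux N).comp M
  refine ⟨2 * b + 2,
    fun x y => (LenLe p₀ ⊓ L').boolIndicator
      (boolPair (instF e j x) (y.take (p₀.eval (instLen e j x.length) + 1))), V,
    fun x y hy => ?_, fun x => ?_⟩
  · -- running time
    set n := x.length with hn
    set m := n / 2 ^ j with hm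
    set Nn := 2 ^ m + n with hNn
    set ℓ := instLen e j n with hℓ
    have hNx : N.OutputsWithin x (boolPair (instF e j x) (ones (p₀.eval (instLen e j n) + 1)))
        ((j + 1) * P.eval (2 ^ (n / 2 ^ j) + n)) := hN x
    have h₁ := outputsWithin_truncMapAux_boolPair N (y := y) hNx
    simp only [length_instF, List.length_replicate] at h₁
    rw [← hn, ← hℓ, ← hm, ← hNn] at h₁
    set y' := y.take (p₀.eval ℓ + 1) with hy'
    have hlen' : y'.length ≤ p₀.eval ℓ + 1 := List.length_take_le _ _
    have h₂ : M.OutputsWithin (boolPair (instF e j x) y') (encodeBool ((LenLe p₀ ⊓ L').boolIndicator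
        (boolPair (instF e j x) y'))) (a * (2 * ℓ + 3 + p₀.eval ℓ) ^ k + a) := by
      refine (hM (boolPair (instF e j x) y')).mono ?_
      simp only [id, length_boolPair, length_instF]
      rw [← hn, ← hℓ]
      have : 2 * ℓ + 2 + y'.length ≤ 2 * ℓ + 3 + p₀.eval ℓ := by omega
      exact Nat.add_le_add_right (Nat.mul_le_mul_left a (Nat.pow_le_pow_left this k)) a
    have h := Turing.TM2ComputableAux.comp_outputsWithin _ _ h₁ h₂
    refine h.mono ?_
    -- everything but `|y| / 2` is at most `(j + 1) Q(Nn) ≤ b 2^n + b`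
    have hbn := hb n
    rw [← hm, ← hNn] at hbn
    have hℓle : ℓ ≤ L.eval Nn := by
      have := instLen_le e j n
      rw [← hm, ← hNn, ← hE₀, ← hℓ] at this
      simp only [hL, eval_add, eval_mul, eval_ofNat, eval_X, eval_C]
      exact this
    have hp₀ : p₀.eval ℓ ≤ (p₀.comp L).eval Nn := by
      rw [eval_comp]; exact TM2Iter.eval_mono p₀ hℓle
    have hQNn : P.eval Nn + (3 * ℓ + 2 * (p₀.eval ℓ + 1) + 2 * n + 11) +
        (a * (2 * ℓ + 3 + p₀.eval ℓ) ^ k + a) ≤ Q.eval Nn := by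
      have h2m : 1 ≤ 2 ^ m := Nat.one_le_two_pow
      have hn' : n ≤ Nn := by rw [hNn]; omega
      have t2 : 3 * ℓ + 2 * (p₀.eval ℓ + 1) + 2 * n + 11 ≤
          (3 * L + 2 * (p₀.comp L + 1) + 2 * X + 11 : Polynomial ℕ).eval Nn := by
        simp only [eval_add, eval_mul, eval_ofNat, eval_X, eval_one]
        linarith [hℓle, hp₀, hn']
      have t3 : a * (2 * ℓ + 3 + p₀.eval ℓ) ^ k + a ≤
          (Polynomial.C a * (2 * L + 3 + p₀.comp L) ^ k + Polynomial.C a : Polynomial ℕ).eval Nn := by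
        simp only [eval_add, eval_mul, eval_ofNat, eval_C, eval_pow]
        have hbase : 2 * ℓ + 3 + p₀.eval ℓ ≤ 2 * L.eval Nn + 3 + (p₀.comp L).eval Nn :=
          Nat.add_le_add (Nat.add_le_add_right (Nat.mul_le_mul_left 2 hℓle) 3) hp₀
        exact Nat.add_le_add_right (Nat.mul_le_mul_left a (Nat.pow_le_pow_left hbase k)) a
      have hQe : Q.eval Nn = P.eval Nn + (3 * L + 2 * (p₀.comp L + 1) + 2 * X + 11 : Polynomial ℕ).eval Nn +
          (Polynomial.C a * (2 * L + 3 + p₀.comp L) ^ k + Polynomial.C a : Polynomial ℕ).eval Nn +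
          (p₀.comp L).eval Nn := by
        simp only [hQ, eval_add]
      rw [hQe]
      linarith
    set R : ℕ := (3 * ℓ + 2 * (p₀.eval ℓ + 1) + 2 * n + 11) + (a * (2 * ℓ + 3 + p₀.eval ℓ) ^ k + a) with hR
    have hmain : (j + 1) * P.eval Nn + R ≤ b * 2 ^ n + b := by
      calc (j + 1) * P.eval Nn + R
          ≤ (j + 1) * P.eval Nn + (j + 1) * R := Nat.add_le_add_left (Nat.le_mul_of_pos_left R (by omega)) _
        _ = (j + 1) * (P.eval Nn + R) := by ring
        _ ≤ (j + 1) * Q.eval Nn := Nat.mul_le_mul_left _ (by rw [hR]; linarith)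
        _ ≤ b * 2 ^ n + b := hbn
    have hy2 : 2 * (y.length / 2) ≤ 2 * ((b + 1) * 2 ^ n + (b + 1)) := by
      rw [show 2 * ((b + 1) * 2 ^ n + (b + 1)) = (2 * b + 2) * 2 ^ n + (2 * b + 2) by ring]
      exact (Nat.mul_div_le y.length 2).trans hy
    have hY : y.length / 2 ≤ (b + 1) * 2 ^ n + (b + 1) := Nat.le_of_mul_le_mul_left hy2 (by norm_num)
    show _ ≤ (2 * b + 2) * 2 ^ n + (2 * b + 2)
    have htotal : a * (2 * ℓ + 3 + p₀.eval ℓ) ^ k + a +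
        ((j + 1) * P.eval Nn + 3 * ℓ + 2 * (p₀.eval ℓ + 1) + 2 * n + y.length / 2 + 11) =
          ((j + 1) * P.eval Nn + R) + y.length / 2 := by rw [hR]; ring
    rw [htotal]
    have e : b * 2 ^ n + b + ((b + 1) * 2 ^ n + (b + 1)) + (2 ^ n + 1) = (2 * b + 2) * 2 ^ n + (2 * b + 2) := by
      ring
    exact (Nat.add_le_add hmain hY).trans (e ▸ Nat.le_add_right _ _)
  · -- correctness
    have hind : ∀ w : List Bool, (LenLe p₀ ⊓ L').boolIndicator w = true ↔ w ∈ LenLe p₀ ∧ w ∈ L' :=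
      fun w => (Set.mem_iff_boolIndicator ((LenLe p₀ ⊓ L' : Language Bool) : Set (List Bool)) w).symm
    rw [mem_simLang_iff]
    constructor
    · rintro ⟨u, hu, hmem⟩
      refine ⟨u, ?_, ?_⟩
      · -- `|u| ≤ p₀ ℓ ≤ Q(Nn) ≤ b 2^n + b`
        have hbn := hb x.length
        have hℓle : instLen e j x.length ≤ L.eval (2 ^ (x.length / 2 ^ j) + x.length) := by
          have := instLen_le e j x.length
          simp only [hL, eval_add, eval_mul, eval_ofNat, eval_X, eval_C]
          exact this
        have hp₀ : p₀.eval (instLen e j x.length) ≤ Q.eval (2 ^ (x.length / 2 ^ j) + x.length) := by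
          have h1 : p₀.eval (instLen e j x.length) ≤ (p₀.comp L).eval (2 ^ (x.length / 2 ^ j) + x.length) := by
            rw [eval_comp]; exact TM2Iter.eval_mono p₀ hℓle
          have h2 : (p₀.comp L).eval (2 ^ (x.length / 2 ^ j) + x.length) ≤
              Q.eval (2 ^ (x.length / 2 ^ j) + x.length) := by
            simp only [hQ, eval_add]; omega
          exact h1.trans h2
        have hQ1 : Q.eval (2 ^ (x.length / 2 ^ j) + x.length) ≤
            (j + 1) * Q.eval (2 ^ (x.length / 2 ^ j) + x.length) := Nat.le_mul_of_pos_left _ (by omega)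
        calc u.length ≤ p₀.eval (instLen e j x.length) := hu
          _ ≤ b * 2 ^ x.length + b := hp₀.trans (hQ1.trans hbn)
          _ ≤ (2 * b + 2) * 2 ^ x.length + (2 * b + 2) :=
              Nat.add_le_add (Nat.mul_le_mul_right _ (by omega)) (by omega)
      · rw [hind, List.take_of_length_le (by omega), boolPair_mem_LenLe, length_instF]
        exact ⟨hu, hmem⟩
    · rintro ⟨y, -, hR⟩
      rw [hind, boolPair_mem_LenLe, length_instF] at hR
      exact ⟨_, hR.1, hR.2⟩

/-! ### The universal referee and its canonical promise problem -/

/-- **The re-layout of the universal referee**: `⟨⟨inst, y⟩, z⟩ ↦ ⟨e, ⟨⟨⟨x, y⟩, z⟩, 1^{|inst|^a}⟩⟩`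
for `inst = ⟨e, ⟨x, u⟩⟩` (run the machine coded by `e` on Arthur's input `⟨⟨x, y⟩, z⟩` with the
budget `|inst|^a`). [cite: AroraBarakCC2009, Thm. 1.9 and §1.4.1] -/
def layF (a : ℕ) : List Bool → List Bool := fun w =>
  boolPair (fstF (fstF (fstF w)))
    (boolPair (boolPair (boolPair (fstF (sndF (fstF (fstF w)))) (sndF (fstF w))) (sndF w))
      (ones ((fstF (fstF w)).length ^ a)))

/-- Value of the re-layout on a well-formed triple. [folklore] -/
theorem layF_apply (a : ℕ) (e x u y z : List Bool) :
    layF a (boolPair (boolPair (boolPair e (boolPair x u)) y) z) =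
      boolPair e (boolPair (boolPair (boolPair x y) z) (ones ((boolPair e (boolPair x u)).length ^ a))) := by
  unfold layF
  simp only [fstF_boolPair, sndF_boolPair]

/-- `layF a ∈ FP`. [cite: AroraBarakCC2009, §1.3] -/
theorem layF_mem_FP (a : ℕ) : layF a ∈ FP := by
  have hff : (fun w : List Bool => fstF (fstF w)) ∈ FP := comp_mem_FP fstF_mem_FP fstF_mem_FP
  have h1 : (fun w : List Bool => fstF (fstF (fstF w))) ∈ FP := comp_mem_FP fstF_mem_FP hff
  have h2 : (fun w : List Bool => fstF (sndF (fstF (fstF w)))) ∈ FP :=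
    comp_mem_FP fstF_mem_FP (comp_mem_FP sndF_mem_FP hff)
  have h3 : (fun w : List Bool => sndF (fstF w)) ∈ FP := comp_mem_FP sndF_mem_FP fstF_mem_FP
  have h4 : (fun w : List Bool => ones ((fstF (fstF w)).length ^ a)) ∈ FP := by
    have heq : (fun w : List Bool => ones ((fstF (fstF w)).length ^ a)) =
        polyFn (X ^ a) ∘ fun w : List Bool => fstF (fstF w) := by
      funext w
      simp only [Function.comp_apply, polyFn_apply, eval_pow, eval_X]
    rw [heq]
    exact comp_mem_FP (polyFn_mem_FP _) hff
  exact pairF_mem_FP h1 (pairF_mem_FP (pairF_mem_FP (pairF_mem_FP h2 h3) sndF_mem_FP) h4)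

/-- **The universal referee** `univRef U a = {w | layF a w ∈ U}`. [cite: AroraBarakCC2009, Thm. 1.9 and §1.4.1] -/
def univRef (U : Language Bool) (a : ℕ) : Language Bool := {w | layF a w ∈ U}

/-- Membership in the universal referee (definitional). [folklore] -/
theorem mem_univRef_iff (U : Language Bool) (a : ℕ) (w : List Bool) : w ∈ univRef U a ↔ layF a w ∈ U :=
  Iff.rfl

/-- The universal referee is in `P` when `U` is. [cite: AroraBarakCC2009, Thm. 1.9] -/
theorem univRef_mem_P {U : Language Bool} (hU : U ∈ Classes.P) (a : ℕ) : univRef U a ∈ Classes.P :=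
  preimage_mem_P hU (layF_mem_FP a)

/-- **The canonical promise problem of the universal referee** (message and coin length `|inst|`):
yes-instances have SOME message accepted with probability `≥ 2/3`, no-instances have EVERY message
accepted with probability `≤ 1/3`. [cite: AroraBarakCC2009, Def. 8.10] -/
def Kprob (U : Language Bool) (a : ℕ) : PromiseProblem where
  yes := {inst | ∃ y : List Bool, y.length = inst.length ∧
    2 / 3 ≤ uniformProb inst.length {z : List Bool | boolPair (boolPair inst y) z ∈ univRef U a}}
  no := {inst | ∀ y : List Bool, y.length = inst.length →
    uniformProb inst.length {z : List Bool | boolPair (boolPair inst y) z ∈ univRef U a} ≤ 1 / 3}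

/-- The canonical promise problem is in `PromiseMA'` (referee `univRef U a`, length polynomial `X`).
[cite: AroraBarakCC2009, Def. 8.10] -/
theorem Kprob_mem_PromiseMA' {U : Language Bool} (hU : U ∈ Classes.P) (a : ℕ) : Kprob U a ∈ PromiseMA' := by
  refine ⟨univRef U a, univRef_mem_P hU a, X, fun x hx => ?_, fun x hx y hy => ?_⟩
  · obtain ⟨y, hy, h⟩ := hx
    exact ⟨y, by rw [eval_X]; exact hy, by rw [eval_X]; exact h⟩
  · have hx' : ∀ y : List Bool, y.length = x.length →
        uniformProb x.length {z : List Bool | boolPair (boolPair x y) z ∈ univRef U a} ≤ 1 / 3 := hx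
    rw [eval_X] at hy ⊢
    exact hx' y hy

/-! ### The simulation -/

/-- **Merlin–Arthur protocols with `2^{⌊n/d⌋}`-bit messages have `NTIME(2ⁿ)` simulations under
`pr-MA ⊆ pr-NP`.** For every `f ∈ FP` there are `d ≥ 1`, a message length `ℓ(n) ≥ 2^{⌊n/d⌋}`, a
threshold `n₀` and `B ∈ NTIME(2ⁿ)` such that for every `x` with `|x| ≥ n₀`: if some
`y ∈ {0,1}^{ℓ(|x|)}` has `Pr_{z ∈ {0,1}^{ℓ(|x|)}}[f ⟨⟨x, y⟩, z⟩ = [true]] ≥ 2/3` then `x ∈ B`, and if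
every such `y` has that probability `≤ 1/3` then `x ∉ B`. Proof: let `M` compute `f` in time `q`,
with code `e` and overhead `p` in the clocked universal acceptance language `U`
(`clockedUniversalAcceptance_holds`); choose `a` with `p(q(5ℓ + 6)) ≤ ℓ^a` for `ℓ ≥ n₀`
(`exists_pow_ge_eval`); the canonical problem `Kprob U a ∈ PromiseMA' ⊆ PromiseNP` is sandwiched
by some `L₀ ∈ NP`, presented by `L' ∈ P` and `p₀`; take `j` from `preimage_mem_NTIME`, `d = 2^j`,
`ℓ = instLen e j`, `B = {x | instF e j x ∈ L₀}`. On `|x| ≥ n₀` the acceptance events of `f` and of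
the universal referee on the instance `instF e j x` coincide up to inclusion in the right direction
(completeness of `U` within the budget, soundness of `U` with uniqueness of machine outputs), so the
two hypotheses put `instF e j x` into the yes- resp. no-part of `Kprob U a`.
[cite: BuhrmanFortnowPavan2004, Lemma 3.7 (proof)] [cite: AroraBarakCC2009, §2.6.2 and Thm. 1.9] -/
theorem exists_NTIME_of_referee (hMA : PromiseMA' ⊆ PromiseNP) {f : List Bool → List Bool}
    (hf : f ∈ FP) :
    ∃ (d : ℕ) (ℓ : ℕ → ℕ) (n₀ : ℕ) (B : Language Bool), 0 < d ∧ B ∈ NTIME (fun n => 2 ^ n) ∧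
      (∀ n, 2 ^ (n / d) ≤ ℓ n) ∧
      ∀ x : List Bool, n₀ ≤ x.length →
        ((∃ y : List Bool, y.length = ℓ x.length ∧
            2 / 3 ≤ uniformProb (ℓ x.length) {z : List Bool | f (boolPair (boolPair x y) z) = [true]}) →
          x ∈ B) ∧
        ((∀ y : List Bool, y.length = ℓ x.length →
            uniformProb (ℓ x.length) {z : List Bool | f (boolPair (boolPair x y) z) = [true]} ≤ 1 / 3) →
          x ∉ B) := by
  obtain ⟨U, hUP, hUniv⟩ := clockedUniversalAcceptance_holds
  obtain ⟨q, Mf, hMf⟩ := hf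
  obtain ⟨e, pU, hcomplete, hsound⟩ := hUniv Mf
  obtain ⟨a, ℓ₁, ha⟩ := exists_pow_ge_eval (pU.comp (q.comp (5 * X + 6)))
  obtain ⟨L₀, hL₀NP, hyes, hno⟩ := hMA (Kprob_mem_PromiseMA' hUP a)
  obtain ⟨L', hL'P, p₀, hL₀⟩ := hL₀NP
  obtain ⟨j, hB⟩ := preimage_mem_NTIME e hL'P p₀
  refine ⟨2 ^ j, instLen e j, ℓ₁, _, Nat.two_pow_pos j, hB, fun n => two_pow_le_instLen e j n,
    fun x hx => ?_⟩
  set ℓ := instLen e j x.length with hℓ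
  have hBiff : x ∈ simLang e j L' p₀ ↔ instF e j x ∈ L₀ := by
    rw [mem_simLang_iff, hL₀ (instF e j x), length_instF]
  have hℓ₁ : ℓ₁ ≤ ℓ := hx.trans ((by omega : x.length ≤ 2 * x.length + 5).trans (le_instLen e j x.length))
  -- the value of `f` versus acceptance by the machine
  have hrun : ∀ w : List Bool, f w = [true] → Mf.OutputsWithin w [true] (q.eval w.length) := by
    intro w hw
    have h := hMf w
    simp only [id] at h
    rw [hw] at h
    exact h
  have hval : ∀ (w : List Bool) (t : ℕ), Mf.OutputsWithin w [true] t → f w = [true] := by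
    intro w t ht
    have h := hMf w
    simp only [id] at h
    exact AvM.outputsWithin_unique Mf h ht
  constructor
  · rintro ⟨y, hy, hpr⟩
    suffices hK : instF e j x ∈ (Kprob U a).yes from hBiff.2 (hyes hK)
    refine ⟨y, by rw [length_instF]; exact hy, ?_⟩
    rw [length_instF]
    refine hpr.trans (uniformProb_mono_of_imp fun z hz hzf => ?_)
    rw [Set.mem_setOf_eq] at hzf
    show boolPair (boolPair (instF e j x) y) z ∈ univRef U a
    rw [mem_univRef_iff, instF, layF_apply, ← instF, length_instF]
    refine hcomplete _ (q.eval (boolPair (boolPair x y) z).length) _ (hrun _ hzf) ?_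
    -- the budget: `pU (q |W|) ≤ pU (q (5ℓ + 6)) ≤ ℓ^a`
    have hW : (boolPair (boolPair x y) z).length ≤ 5 * ℓ + 6 := by
      simp only [length_boolPair]
      rw [hy, hz]
      have := le_instLen e j x.length
      omega
    calc pU.eval (q.eval (boolPair (boolPair x y) z).length)
        ≤ pU.eval (q.eval (5 * ℓ + 6)) := TM2Iter.eval_mono pU (TM2Iter.eval_mono q hW)
      _ = (pU.comp (q.comp (5 * X + 6))).eval ℓ := by
          simp [eval_comp, eval_add, eval_mul, eval_X]
      _ ≤ ℓ ^ a := ha ℓ hℓ₁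
  · intro hall hxB
    have hmem : instF e j x ∈ L₀ := hBiff.1 hxB
    have hno' : instF e j x ∈ (Kprob U a).no := by
      show ∀ y : List Bool, y.length = (instF e j x).length →
        uniformProb (instF e j x).length {z : List Bool | boolPair (boolPair (instF e j x) y) z ∈ univRef U a} ≤ 1 / 3
      intro y hy
      rw [length_instF] at hy ⊢
      refine (uniformProb_mono_of_imp fun z hz hzR => ?_).trans (hall y hy)
      rw [Set.mem_setOf_eq]
      have hzR' : boolPair (boolPair (instF e j x) y) z ∈ univRef U a := hzR
      rw [mem_univRef_iff, instF, layF_apply] at hzR'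
      obtain ⟨t, ht⟩ := hsound _ _ hzR'
      exact hval _ t ht
    have hc : instF e j x ∈ L₀ᶜ := hno hno'
    exact (show instF e j x ∈ L₀ᶜ ↔ instF e j x ∉ L₀ from Iff.rfl).1 hc hmem

end MAScale

end Literature.Computability.Complexity

end
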